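import Summits.KontsevichZagierPeriods.KontsevichZagierPeriods.Theorems.TerasomaMultiplicationMultiplicationAccessibleLiouvilleGlue

/-!
# `MultiplicationAccessible` (stmt-KontsevichZagierPeriods-12305), line `shifted-family-prime-sieve`:
the CORNER GLUE — shifted family = the corner identity `(♣)` + the landed Dirichlet charts

The Liouville rotation flow (idea card `liouville-rotation-flow`, lead c2) transports the shifted box
`[(0,1)^n, ∏_(k<n) t_k^(x+k/n−1)(1−t_k)^(s−1)]` along the explicit closed form
`Ξ = (1/n)(1−z)^(−ns) Σ_k (1−t_k)(Φ∘τ^k) ι_(t_k∂_k)Vol` (`z = (∏t_k)^(1/n)`) to the exceptional face of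
the corner blow-up `t_k = 1 − yθ_k`, whose density is EXACTLY the Dirichlet density
`n^(ns−1)∏θ_k^(s−1)`; the resulting statement of the calculus is the corner identity

  `(♣)_n  [(0,1)^n, ∏ t_k^(x+k/n−1)(1−t_k)^(s−1)] ∼ [(0,1)×Δ_m, n·w₀^(nx−1)(1−w₀)^(ns−1) · n^(ns−1)(∏_(i<m) w_(i+1)^(s−1))(1−Σ w_(i+1))^(s−1)]`

(`m = n − 1`; value identity `∏B(x+k/n,s) = n^(ns)B(nx,ns)Γ(s)^n/Γ(ns)`, Gauss). This file proves the
book-keeping, sorry-free: **`(♣)_n` for all `x, s` gives the shifted family `GM(m; x, s)` for all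
`x, s`** (`gm_of_corner`): the right side of `(♣)` is a relabelling of the Fubini product of
`n·β(nx, ns)` with `n^(ns−1)·D_m(s; s)` (`KZ.exists_dirichletRep`), so in the formal period ring
`⟦right⟧ = ⟦n⟧ g(nx,ns) · ⟦n^(ns−1)⟧ ∏_(j<m) g(s, (j+1)s)` (`KZ.toFormalPeriod_of_constMul`,
`KZ.dirichletRep_toFormalPeriod_eq_prod`), which is the right side of `GM` after `m` reflections.
With the Sieve this turns each registered stub of the line into ONE Stokes statement `(♣)_p`.
References: Andrews–Askey–Roy 1999, Thm 1.5.2, Thm 1.8.1; Kontsevich–Zagier 2001 §1.2.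
-/

noncomputable section

open MeasureTheory Set Finset
open scoped BigOperators
open Literature.NumberTheory.Transcendental
open Literature.NumberTheory.Transcendental.KZ
open Summit.KontsevichZagierPeriods.MultiplicationAccessible.Negative (boxDom)

namespace Summit.KontsevichZagierPeriods.TerasomaMultiplication.MultiplicationAccessible

namespace Corner

/-- The relabelling `Fin (1+m) ≃ Fin (m+1)` sends the first-block coordinate to `0`. [folklore] -/
theorem finCongr_symm_castAdd (m : ℕ) :
    (finCongr (Nat.add_comm m 1)).symm (Fin.castAdd m (0 : Fin 1)) = 0 := by
  rw [Equiv.symm_apply_eq]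
  exact (finCongr_add_comm_zero m).symm

/-- The relabelling `Fin (1+m) ≃ Fin (m+1)` sends the `j`-th second-block coordinate to `succ j`.
[folklore] -/
theorem finCongr_symm_natAdd (m : ℕ) (j : Fin m) :
    (finCongr (Nat.add_comm m 1)).symm (Fin.natAdd 1 j) = j.succ := by
  rw [Equiv.symm_apply_eq]
  exact (finCongr_add_comm_succ m j).symm

/-- **The right side of `(♣)` in `P`.** For the pinned Beta family `B`, a Dirichlet representation
`D = D_m(s; s)` and `n = m + 1`, the relabelled product
`((n·β(nx,ns)) × (n^(ns−1)·D)).reindex` has formal period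
`⟦n⟧ g(nx, ns) · (⟦n^(ns−1)⟧ ∏_(j<m) g(s, (j+1)s))`. [cite: AndrewsAskeyRoy1999, Thm 1.8.1] -/
theorem toFormalPeriod_cornerRep {B : ℚ → ℚ → IntegralRep 1}
    (hB : ∀ p q, 0 < p → 0 < q → (B p q).domain = {t | t 0 ∈ Set.Ioo (0:ℝ) 1} ∧
      (B p q).integrand = fun t => (t 0) ^ ((p:ℝ) - 1) * (1 - t 0) ^ ((q:ℝ) - 1))
    (m : ℕ) {x s : ℚ} (hs : 0 < s) (D : IntegralRep m)
    (hDd : D.domain = {u | (∀ i, 0 < u i) ∧ ∑ i, u i < 1})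
    (hDi : D.integrand = fun u => (∏ i, (u i) ^ ((s:ℝ) - 1)) * (1 - ∑ i, u i) ^ ((s:ℝ) - 1)) :
    toFormalPeriod (of ((((B (((m:ℚ) + 1) * x) (((m:ℚ) + 1) * s)).constMul ((m:ℝ) + 1)
        (Liouville.isAlgebraic_natSucc m)).prod
        (D.constMul _ (isAlgebraic_gaussMultConst m s))).reindex
          (finCongr (Nat.add_comm m 1)).symm)) =
      toFormalPeriod (of (IntegralRep.unit.constMul ((m:ℝ) + 1) (Liouville.isAlgebraic_natSucc m))) *
        toFormalPeriod (of (B (((m:ℚ) + 1) * x) (((m:ℚ) + 1) * s))) *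
        (toFormalPeriod (of (IntegralRep.unit.constMul _ (isAlgebraic_gaussMultConst m s))) *
          ∏ j : Fin m, toFormalPeriod (of (B s ((((j:ℕ):ℚ) + 1) * s)))) := by
  have hrel := of_sub_of_reindex_mem_relations
    (((B (((m:ℚ) + 1) * x) (((m:ℚ) + 1) * s)).constMul ((m:ℝ) + 1)
      (Liouville.isAlgebraic_natSucc m)).prod (D.constMul _ (isAlgebraic_gaussMultConst m s)))
    (finCongr (Nat.add_comm m 1)).symm
  -- the Dirichlet representation peeled onto Beta classes
  have hbpos : ∀ j : Fin m, 0 < (((j:ℕ):ℚ) + 1) * s := fun j => by positivity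
  have hDP : toFormalPeriod (of D) = ∏ j : Fin m, toFormalPeriod (of (B s ((((j:ℕ):ℚ) + 1) * s))) :=
    dirichletRep_toFormalPeriod_eq_prod s hs m s hs D (fun j => (((j:ℕ):ℚ) + 1) * s)
      (fun j => B s ((((j:ℕ):ℚ) + 1) * s)) hDd (fun u _ => by rw [hDi]) (fun j => by ring)
      (fun j => (hB _ _ hs (hbpos j)).1)
      (fun j => by rw [(hB _ _ hs (hbpos j)).2]; exact fun _ _ => rfl)
  rw [← toFormalPeriod_eq_iff.mpr hrel, ← toFormalPeriod_of_mul_of,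
    toFormalPeriod_of_constMul ((m:ℝ) + 1) (Liouville.isAlgebraic_natSucc m)
      (B (((m:ℚ) + 1) * x) (((m:ℚ) + 1) * s)),
    toFormalPeriod_of_constMul _ (isAlgebraic_gaussMultConst m s) D, hDP]

/-- The domain of the relabelled product is the stated right domain of `(♣)`. [folklore] -/
theorem cornerRep_domain (m : ℕ) (β : IntegralRep 1) (hβ : β.domain = {t | t 0 ∈ Set.Ioo (0:ℝ) 1})
    (D : IntegralRep m) (hDd : D.domain = {u | (∀ i, 0 < u i) ∧ ∑ i, u i < 1}) :
    ((β.prod D).reindex (finCongr (Nat.add_comm m 1)).symm).domain =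
      {w : Fin (m + 1) → ℝ | w 0 ∈ Set.Ioo (0:ℝ) 1 ∧ (∀ i : Fin m, 0 < w i.succ) ∧
        ∑ i : Fin m, w i.succ < 1} := by
  ext w
  rw [IntegralRep.reindex_domain, mem_setOf_eq, IntegralRep.prod_domain,
    IntegralRep.mem_prodDomain, hβ, hDd]
  simp only [mem_setOf_eq, finCongr_symm_natAdd, finCongr_symm_castAdd]

/-- The integrand of the relabelled product is the stated right integrand of `(♣)` on its domain.
[folklore] -/
theorem cornerRep_integrand {B : ℚ → ℚ → IntegralRep 1}
    (hB : ∀ p q, 0 < p → 0 < q → (B p q).domain = {t | t 0 ∈ Set.Ioo (0:ℝ) 1} ∧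
      (B p q).integrand = fun t => (t 0) ^ ((p:ℝ) - 1) * (1 - t 0) ^ ((q:ℝ) - 1))
    (m : ℕ) {x s : ℚ} (hx : 0 < x) (hs : 0 < s) (D : IntegralRep m)
    (hDi : D.integrand = fun u => (∏ i, (u i) ^ ((s:ℝ) - 1)) * (1 - ∑ i, u i) ^ ((s:ℝ) - 1))
    (w : Fin (m + 1) → ℝ) :
    ((((B (((m:ℚ) + 1) * x) (((m:ℚ) + 1) * s)).constMul ((m:ℝ) + 1)
        (Liouville.isAlgebraic_natSucc m)).prod
        (D.constMul _ (isAlgebraic_gaussMultConst m s))).reindex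
          (finCongr (Nat.add_comm m 1)).symm).integrand w =
      ((m:ℝ) + 1) * ((w 0) ^ (((m:ℝ) + 1) * (x:ℝ) - 1) * (1 - w 0) ^ (((m:ℝ) + 1) * (s:ℝ) - 1)) *
        (((m:ℝ) + 1) ^ (((m:ℝ) + 1) * (s:ℝ) - 1) *
          ((∏ i : Fin m, (w i.succ) ^ ((s:ℝ) - 1)) * (1 - ∑ i : Fin m, w i.succ) ^ ((s:ℝ) - 1))) := by
  rw [IntegralRep.reindex_integrand]
  dsimp only
  rw [IntegralRep.prod_integrand_eq, IntegralRep.prodFun_apply, IntegralRep.integrand_constMul,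
    IntegralRep.integrand_constMul, (hB _ _ (by positivity) (by positivity)).2, hDi]
  simp only [finCongr_symm_natAdd, finCongr_symm_castAdd]
  push_cast
  ring

end Corner

/-- **The corner glue**: if the corner identity `(♣)_n` holds for all rational `x, s > 0` — every
box representation of `∏_(k<n) B(x+k/n, s)` is equivalent to every representation pinned as
`[(0,1)×Δ_m, n·w₀^(nx−1)(1−w₀)^(ns−1)·n^(ns−1)(∏ w_(i+1)^(s−1))(1−Σw_(i+1))^(s−1)]` — then the shifted
Gauss multiplication `GM(m; x, s)` holds inside the rules for all rational `x, s > 0`. In the formal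
period ring: `⟦shifted box⟧ = ⟦corner rep⟧ = ⟦n⟧g(nx,ns)⟦n^(ns−1)⟧∏_j g(s,(j+1)s)`
(`Corner.toFormalPeriod_cornerRep`) `= ⟦n^(ns)⟧ g(nx,ns) ∏_j g((j+1)s, s) = ⟦GM right box⟧`.
[cite: AndrewsAskeyRoy1999, Thm 1.5.2] -/
theorem gm_of_corner :
    ∀ (m : ℕ), (∀ (x s : ℚ), 0 < x → 0 < s → ∀ (r r' : KZ.IntegralRep (m + 1)),
        r.domain = {z | ∀ i, z i ∈ Set.Ioo (0:ℝ) 1} →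
        Set.EqOn r.integrand (fun z => ∏ k : Fin (m + 1),
          (z k) ^ ((x:ℝ) + ((k:ℕ):ℝ) / ((m:ℝ) + 1) - 1) * (1 - z k) ^ ((s:ℝ) - 1)) r.domain →
        r'.domain = {w | w 0 ∈ Set.Ioo (0:ℝ) 1 ∧ (∀ i : Fin m, 0 < w i.succ) ∧
          ∑ i : Fin m, w i.succ < 1} →
        Set.EqOn r'.integrand (fun w => ((m:ℝ) + 1) *
          ((w 0) ^ (((m:ℝ) + 1) * (x:ℝ) - 1) * (1 - w 0) ^ (((m:ℝ) + 1) * (s:ℝ) - 1)) *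
          (((m:ℝ) + 1) ^ (((m:ℝ) + 1) * (s:ℝ) - 1) *
            ((∏ i : Fin m, (w i.succ) ^ ((s:ℝ) - 1)) * (1 - ∑ i : Fin m, w i.succ) ^ ((s:ℝ) - 1))))
          r'.domain →
        KZ.Equivalent r r') →
      ∀ (x s : ℚ), 0 < x → 0 < s → ∀ (r r' : KZ.IntegralRep (m + 1)),
        r.domain = {z | ∀ i, z i ∈ Set.Ioo (0:ℝ) 1} →
        Set.EqOn r.integrand (fun z => ∏ k : Fin (m + 1),
          (z k) ^ ((x:ℝ) + ((k:ℕ):ℝ) / ((m:ℝ) + 1) - 1) * (1 - z k) ^ ((s:ℝ) - 1)) r.domain →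
        r'.domain = {z | ∀ i, z i ∈ Set.Ioo (0:ℝ) 1} →
        Set.EqOn r'.integrand (fun z => ((m:ℝ) + 1) ^ (((m:ℝ) + 1) * (s:ℝ)) *
          ((z 0) ^ (((m:ℝ) + 1) * (x:ℝ) - 1) * (1 - z 0) ^ (((m:ℝ) + 1) * (s:ℝ) - 1)) *
          ∏ j : Fin m, (z j.succ) ^ ((((j:ℕ):ℝ) + 1) * (s:ℝ) - 1) * (1 - z j.succ) ^ ((s:ℝ) - 1))
          r'.domain →
        KZ.Equivalent r r' := by
  intro m hC x s hx hs r r' hr hri hr' hri'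
  obtain ⟨B, hB⟩ := MultGlue.exists_betaFamily
  obtain ⟨D, hDd, hDi⟩ := exists_dirichletRep s hs m s hs
  -- the corner representation and `(♣)` applied to it
  set ρ := (((B (((m:ℚ) + 1) * x) (((m:ℚ) + 1) * s)).constMul ((m:ℝ) + 1)
    (Liouville.isAlgebraic_natSucc m)).prod (D.constMul _ (isAlgebraic_gaussMultConst m s))).reindex
      (finCongr (Nat.add_comm m 1)).symm with hρ
  have hρd := Corner.cornerRep_domain m ((B (((m:ℚ) + 1) * x) (((m:ℚ) + 1) * s)).constMul
    ((m:ℝ) + 1) (Liouville.isAlgebraic_natSucc m))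
    (by rw [IntegralRep.domain_constMul]; exact (hB _ _ (by positivity) (by positivity)).1)
    (D.constMul _ (isAlgebraic_gaussMultConst m s)) (by rw [IntegralRep.domain_constMul, hDd])
  have e1 : Equivalent r ρ :=
    hC x s hx hs r ρ hr hri hρd fun w _ => Corner.cornerRep_integrand hB m hx hs D hDi w
  -- the formal period of the corner representation
  have hρP := Corner.toFormalPeriod_cornerRep hB m (x := x) hs D hDd hDi
  -- the formal period of the GM right box
  have hα'pos : ∀ k : Fin (m + 1),
      0 < (if (k : ℕ) = 0 then ((m : ℚ) + 1) * x else (k : ℚ) * s) := fun k => by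
    split_ifs with h; exacts [by positivity, MultGlue.natCast_mul_pos h hs]
  have hβ'pos : ∀ k : Fin (m + 1), 0 < (if (k : ℕ) = 0 then ((m : ℚ) + 1) * s else s) :=
    fun k => by split_ifs <;> positivity
  have hr'P := MultGlue.toFormalPeriod_box hB (MultGlue.isAlgebraic_gaussConst m s) hα'pos hβ'pos
    hr' (fun z hz => (hri' hz).trans (GlueFromParts.gmRight_eq m x s z).symm)
  have hR : ∏ k : Fin (m + 1), toFormalPeriod (of (B
        (if (k : ℕ) = 0 then ((m : ℚ) + 1) * x else (k : ℚ) * s)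
        (if (k : ℕ) = 0 then ((m : ℚ) + 1) * s else s))) =
      toFormalPeriod (of (B (((m:ℚ) + 1) * x) (((m:ℚ) + 1) * s))) *
        ∏ j : Fin m, toFormalPeriod (of (B ((((j:ℕ):ℚ) + 1) * s) s)) := by
    rw [Fin.prod_univ_succ]
    simp [Fin.val_succ]
  have reflD : ∏ j : Fin m, toFormalPeriod (of (B s ((((j:ℕ):ℚ) + 1) * s))) =
      ∏ j : Fin m, toFormalPeriod (of (B ((((j:ℕ):ℚ) + 1) * s) s)) :=
    Finset.prod_congr rfl fun j _ => Doubling.refl_eq hB hs (by positivity)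
  have hconst : toFormalPeriod (of (IntegralRep.unit.constMul ((m:ℝ) + 1)
      (Liouville.isAlgebraic_natSucc m))) *
      toFormalPeriod (of (IntegralRep.unit.constMul (((m:ℝ) + 1) ^ (((m:ℝ) + 1) * s - 1))
        (isAlgebraic_gaussMultConst m s))) =
      toFormalPeriod (of (IntegralRep.unit.constMul (((m:ℝ) + 1) ^ (((m:ℝ) + 1) * (s:ℝ)))
        (MultGlue.isAlgebraic_gaussConst m s))) := by
    rw [← MultGlue.ptConst_mul (Liouville.isAlgebraic_natSucc m) (isAlgebraic_gaussMultConst m s)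
      ((Liouville.isAlgebraic_natSucc m).mul (isAlgebraic_gaussMultConst m s))]
    refine MultGlue.ptConst_congr _ _ ?_
    have hn : (0:ℝ) < (m:ℝ) + 1 := by positivity
    rw [Real.rpow_sub_one hn.ne', mul_div_cancel₀ _ hn.ne']
  refine toFormalPeriod_eq_iff.mp (e1.toFormalPeriod_eq.trans ?_)
  rw [hρP, hr'P, hR, reflD, ← hconst]
  ring

/-- **The corner glue, pointwise in `(x, s)`**: the corner identity `(♣)_n` at ONE parameter `(x, s)`
already gives `GM(m; x, s)` at that parameter (the proof of `gm_of_corner` uses its hypothesis only at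
the same `(x, s)`); this is the form the Stokes argument feeds (it is proved for `x > 1`, `s > 2` and
transported to all parameters by the translation sub-goals). [cite: AndrewsAskeyRoy1999, Thm 1.5.2] -/
theorem gm_of_corner_at :
    ∀ (m : ℕ) (x s : ℚ), 0 < x → 0 < s → (∀ (r r' : KZ.IntegralRep (m + 1)),
        r.domain = {z | ∀ i, z i ∈ Set.Ioo (0:ℝ) 1} →
        Set.EqOn r.integrand (fun z => ∏ k : Fin (m + 1),
          (z k) ^ ((x:ℝ) + ((k:ℕ):ℝ) / ((m:ℝ) + 1) - 1) * (1 - z k) ^ ((s:ℝ) - 1)) r.domain →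
        r'.domain = {w | w 0 ∈ Set.Ioo (0:ℝ) 1 ∧ (∀ i : Fin m, 0 < w i.succ) ∧
          ∑ i : Fin m, w i.succ < 1} →
        Set.EqOn r'.integrand (fun w => ((m:ℝ) + 1) *
          ((w 0) ^ (((m:ℝ) + 1) * (x:ℝ) - 1) * (1 - w 0) ^ (((m:ℝ) + 1) * (s:ℝ) - 1)) *
          (((m:ℝ) + 1) ^ (((m:ℝ) + 1) * (s:ℝ) - 1) *
            ((∏ i : Fin m, (w i.succ) ^ ((s:ℝ) - 1)) * (1 - ∑ i : Fin m, w i.succ) ^ ((s:ℝ) - 1))))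
          r'.domain →
        KZ.Equivalent r r') →
      ∀ (r r' : KZ.IntegralRep (m + 1)),
        r.domain = {z | ∀ i, z i ∈ Set.Ioo (0:ℝ) 1} →
        Set.EqOn r.integrand (fun z => ∏ k : Fin (m + 1),
          (z k) ^ ((x:ℝ) + ((k:ℕ):ℝ) / ((m:ℝ) + 1) - 1) * (1 - z k) ^ ((s:ℝ) - 1)) r.domain →
        r'.domain = {z | ∀ i, z i ∈ Set.Ioo (0:ℝ) 1} →
        Set.EqOn r'.integrand (fun z => ((m:ℝ) + 1) ^ (((m:ℝ) + 1) * (s:ℝ)) *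
          ((z 0) ^ (((m:ℝ) + 1) * (x:ℝ) - 1) * (1 - z 0) ^ (((m:ℝ) + 1) * (s:ℝ) - 1)) *
          ∏ j : Fin m, (z j.succ) ^ ((((j:ℕ):ℝ) + 1) * (s:ℝ) - 1) * (1 - z j.succ) ^ ((s:ℝ) - 1))
          r'.domain →
        KZ.Equivalent r r' := by
  intro m x s hx hs hC r r' hr hri hr' hri'
  obtain ⟨B, hB⟩ := MultGlue.exists_betaFamily
  obtain ⟨D, hDd, hDi⟩ := exists_dirichletRep s hs m s hs
  set ρ := (((B (((m:ℚ) + 1) * x) (((m:ℚ) + 1) * s)).constMul ((m:ℝ) + 1)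
    (Liouville.isAlgebraic_natSucc m)).prod (D.constMul _ (isAlgebraic_gaussMultConst m s))).reindex
      (finCongr (Nat.add_comm m 1)).symm with hρ
  have hρd := Corner.cornerRep_domain m ((B (((m:ℚ) + 1) * x) (((m:ℚ) + 1) * s)).constMul
    ((m:ℝ) + 1) (Liouville.isAlgebraic_natSucc m))
    (by rw [IntegralRep.domain_constMul]; exact (hB _ _ (by positivity) (by positivity)).1)
    (D.constMul _ (isAlgebraic_gaussMultConst m s)) (by rw [IntegralRep.domain_constMul, hDd])
  have e1 : Equivalent r ρ := hC r ρ hr hri hρd fun w _ => Corner.cornerRep_integrand hB m hx hs D hDi w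
  have hρP := Corner.toFormalPeriod_cornerRep hB m (x := x) hs D hDd hDi
  have hα'pos : ∀ k : Fin (m + 1),
      0 < (if (k : ℕ) = 0 then ((m : ℚ) + 1) * x else (k : ℚ) * s) := fun k => by
    split_ifs with h; exacts [by positivity, MultGlue.natCast_mul_pos h hs]
  have hβ'pos : ∀ k : Fin (m + 1), 0 < (if (k : ℕ) = 0 then ((m : ℚ) + 1) * s else s) :=
    fun k => by split_ifs <;> positivity
  have hr'P := MultGlue.toFormalPeriod_box hB (MultGlue.isAlgebraic_gaussConst m s) hα'pos hβ'pos
    hr' (fun z hz => (hri' hz).trans (GlueFromParts.gmRight_eq m x s z).symm)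
  have hR : ∏ k : Fin (m + 1), toFormalPeriod (of (B
        (if (k : ℕ) = 0 then ((m : ℚ) + 1) * x else (k : ℚ) * s)
        (if (k : ℕ) = 0 then ((m : ℚ) + 1) * s else s))) =
      toFormalPeriod (of (B (((m:ℚ) + 1) * x) (((m:ℚ) + 1) * s))) *
        ∏ j : Fin m, toFormalPeriod (of (B ((((j:ℕ):ℚ) + 1) * s) s)) := by
    rw [Fin.prod_univ_succ]
    simp [Fin.val_succ]
  have reflD : ∏ j : Fin m, toFormalPeriod (of (B s ((((j:ℕ):ℚ) + 1) * s))) =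
      ∏ j : Fin m, toFormalPeriod (of (B ((((j:ℕ):ℚ) + 1) * s) s)) :=
    Finset.prod_congr rfl fun j _ => Doubling.refl_eq hB hs (by positivity)
  have hconst : toFormalPeriod (of (IntegralRep.unit.constMul ((m:ℝ) + 1)
      (Liouville.isAlgebraic_natSucc m))) *
      toFormalPeriod (of (IntegralRep.unit.constMul (((m:ℝ) + 1) ^ (((m:ℝ) + 1) * s - 1))
        (isAlgebraic_gaussMultConst m s))) =
      toFormalPeriod (of (IntegralRep.unit.constMul (((m:ℝ) + 1) ^ (((m:ℝ) + 1) * (s:ℝ)))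
        (MultGlue.isAlgebraic_gaussConst m s))) := by
    rw [← MultGlue.ptConst_mul (Liouville.isAlgebraic_natSucc m) (isAlgebraic_gaussMultConst m s)
      ((Liouville.isAlgebraic_natSucc m).mul (isAlgebraic_gaussMultConst m s))]
    refine MultGlue.ptConst_congr _ _ ?_
    have hn : (0:ℝ) < (m:ℝ) + 1 := by positivity
    rw [Real.rpow_sub_one hn.ne', mul_div_cancel₀ _ hn.ne']
  refine toFormalPeriod_eq_iff.mp (e1.toFormalPeriod_eq.trans ?_)
  rw [hρP, hr'P, hR, reflD, ← hconst]
  ring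

end Summit.KontsevichZagierPeriods.TerasomaMultiplication.MultiplicationAccessible

end
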